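import Summits.AtomisticToContinuum.BoseEinsteinCondensation.Theorems.BECThomsonPrincipleGDTransferSeededRoughDefs
import Summits.AtomisticToContinuum.BoseEinsteinCondensation.Theorems.PeriodicIRBound.Negative.AEClass

/-!
# Route `BECThomsonPrinciple`, crux `GDTransfer` (stmt-AtomisticToContinuum-9482), line `seeded-continuity`:
# registered stub `periodicBECFor_of_ae_eq` (= v5 `stub_roughNull`) — null modifications of the profile

Supports (does not close) stmt-AtomisticToContinuum-9482.  Proves the registered stub
`periodicBECFor_of_ae_eq` (the content of `Sig.stub_roughNull` of
`BECThomsonPrincipleGDTransferSeededRoughDefs.lean`): if two radial profiles `v w : ℝ → ℝ≥0∞` have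
Lebesgue-a.e. equal radial lifts `x ↦ v ‖x‖`, `x ↦ w ‖x‖` on `ℝ³`, then `PeriodicBECFor w → PeriodicBECFor v`.

The periodic BEC statement `PeriodicBECFor v` mentions `v` only through `periodicEnergy v Ψ` and
`periodicGroundStateEnergy v N L`, and these see `v` only through the a.e. class of
`X ↦ Σ_{i<j} v^per(xᵢ − xⱼ)` on configuration space `(ℝ³)^N`: each pair map `X ↦ xᵢ − xⱼ` (`i ≠ j`) is
the `i`-th coordinate of a unimodular shear of Haar measure, so it pulls Lebesgue-null sets back to null
sets, and the countably many lattice translates in `v^per` preserve a.e. equality.  This chain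
(`ae_pairDiff`, `periodizedPotential_congr_ae`, `periodicInteraction_congr_ae`, `periodicEnergy_congr_ae`,
`periodicGroundStateEnergy_congr_ae`) is ALREADY in the tree, in
`Theorems/PeriodicIRBound/Negative/AEClass.lean` (namespace
`…Theorems.PeriodicIRBound.Negative`, stated for the same Literature objects `periodicEnergy`,
`periodicGroundStateEnergy` of `Literature/…/PeriodicBoseGas.lean`); it is imported, not restated.  What
is proved here is the transport of `PeriodicBECFor` along those two identities
(`periodicBECFor_congr_ae`, an `Iff`) and the registered one-directional form with the (unused)
admissibility hypotheses of the registered signature.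

Also here: the registered v5 stub `stub_roughNull : Sig.stub_roughNull` itself (skeleton v5, …SeededRoughDefs p147682),
a one-liner over `periodicBECFor_of_ae_eq`.  Not here: the essentially rough regime (`Sig.stub_essentiallyRough`, open).

References: LSSY2005 §1.2 (1.16) and Ch. 2 (2.1) (admissible class); Fournais2020 (1.1) (periodic energy form).
-/

noncomputable section

open MeasureTheory Filter
open scoped ENNReal

namespace Summit.AtomisticToContinuum.BoseEinsteinCondensation.Cruxes.GDTransfer.Seeded

open Literature.MathematicalPhysics.QuantumManyBody.BoseGas
open Summit.AtomisticToContinuum.BoseEinsteinCondensation.Cruxes.GDTransfer.DysonDressedWitness (PeriodicBECFor)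
open Summit.AtomisticToContinuum.BoseEinsteinCondensation.Theorems.PeriodicIRBound.Negative
  (periodicEnergy_congr_ae periodicGroundStateEnergy_congr_ae)

/-- **`PeriodicBECFor` depends on the profile only through the a.e. class of its radial lift**: if
`v ‖x‖ = w ‖x‖` for Lebesgue-a.e. `x ∈ ℝ³`, then `PeriodicBECFor v ↔ PeriodicBECFor w` (every periodic
trial state has the same energy for `v` and `w`, `periodicEnergy_congr_ae`, hence the same ground-state
energy, `periodicGroundStateEnergy_congr_ae`; the near-minimiser condition and the conclusion of
`PeriodicBECFor` are otherwise profile-free). -/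
theorem periodicBECFor_congr_ae {v w : ℝ → ℝ≥0∞} (h : ∀ᵐ x : Space, v ‖x‖ = w ‖x‖) :
    PeriodicBECFor v ↔ PeriodicBECFor w := by
  unfold PeriodicBECFor
  simp only [periodicEnergy_congr_ae h, periodicGroundStateEnergy_congr_ae h]

/-- **Registered stub `periodicBECFor_of_ae_eq` (= v5 `stub_roughNull`) of the line `seeded-continuity`.**
A null modification of the radial lift does not change the periodic BEC statement: for profiles
`v w : ℝ → ℝ≥0∞` with `v ‖x‖ = w ‖x‖` for a.e. `x ∈ ℝ³`, `PeriodicBECFor w → PeriodicBECFor v`.  The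
admissibility hypotheses (`IsRepulsiveFiniteRange`: measurable, finite range) of the registered signature
are not needed and are kept only to match it verbatim. -/
theorem periodicBECFor_of_ae_eq : ∀ v w : ℝ → ENNReal, Literature.MathematicalPhysics.QuantumManyBody.BoseGas.IsRepulsiveFiniteRange v → Literature.MathematicalPhysics.QuantumManyBody.BoseGas.IsRepulsiveFiniteRange w → (∀ᵐ x : Literature.MathematicalPhysics.QuantumManyBody.BoseGas.Space, v ‖x‖ = w ‖x‖) → Summit.AtomisticToContinuum.BoseEinsteinCondensation.Cruxes.GDTransfer.DysonDressedWitness.PeriodicBECFor w → Summit.AtomisticToContinuum.BoseEinsteinCondensation.Cruxes.GDTransfer.DysonDressedWitness.PeriodicBECFor v :=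
  fun _ _ _ _ h hw => (periodicBECFor_congr_ae h).2 hw

/-- **Registered stub `stub_roughNull` of skeleton v5** (line `seeded-continuity`, crux `GDTransfer`,
stmt-AtomisticToContinuum-9482): null modifications of the radial lift do not change the periodic BEC statement,
so a profile a.e. equal to a soft one inherits the soft conclusion. -/
theorem stub_roughNull : Sig.stub_roughNull :=
  periodicBECFor_of_ae_eq

end Summit.AtomisticToContinuum.BoseEinsteinCondensation.Cruxes.GDTransfer.Seeded

end
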